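import Mathlib
import Summits.ValiantsHypothesis.ValiantsHypothesis.Theorems.NewtonTauWeak.Negative.Zonogon
import Summits.ValiantsHypothesis.ValiantsHypothesis.Theorems.NewtonUnitEquationsBinomialPencil

/-!
# `NewtonTauWeak` (stmt-ValiantsHypothesis-5904), line `binomial-normal-form`: the level bound —
# the open stub holds for every exponent list of polynomial lattice width

Support file for the crux
`Summit.ValiantsHypothesis.ValiantsHypothesis.Theses.NewtonUnitEquations.NewtonTauWeak`
(KPTT arXiv:1308.2286, Conjecture 1 in the weak form of their Theorem 1), open stub
`stub_binomialNewtonTauCommon`: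
`∃ b, ∀ K N c ρ d, vert(Σ_{l<K} c_l Π_{j<N} (1 - ρ_{lj} X^{d_j})) ≤ (K N+2)^b`.

THE LEVEL BOUND.  A convex polygon has at most two vertices on any line, so for every nonzero linear
functional `ℓ(x) = a x₀ + b x₁` the number of Newton vertices of a bivariate polynomial `p` is at most
twice the number of values ("levels") `ℓ` takes on `supp p` (`vert_le_two_mul_card_levels`).  Every
exponent in the support of the stub's sum is a subset sum `Σ_{j∈J} d_j`, whose level lies in an integer
interval of length `Σ_j |ℓ(d_j)|`; hence, for ALL `K`, all scalars and all coefficients,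

  `vert(Σ_{l<K} c_l Π_{j<N} (1 - ρ_{lj} X^{d_j})) ≤ 2 · (1 + Σ_j |a (d_j)₀ + b (d_j)₁|)`

for every `(a, b) ∈ ℤ² ∖ 0` (`vert_binomialSum_le_levels`).  So the stub is a THEOREM (with `b = 1`,
uniformly in `K`!) on every family of exponent lists of polynomially bounded lattice width in some
direction — in particular on the "hexagon"/block frames `d_j ∈ {(1,0), (0,1), (1,1)}` with arbitrary
multiplicities (`vert ≤ 2 (N+1)`, `vert_binomialSum_hexagon_le`, via `ℓ = x₀ - x₁`), which carried most
of the cancellation-design experiments of this crux so far (cdisprove N5 E4, lead c1 §5/§7): no design on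
such frames can refute the stub, whatever `K`.  A counterexample to the stub needs exponent lists whose
subset sums take super-polynomially many values under EVERY nonzero integer functional (e.g. digit
frames `(2^i, 0), (0, 2^i), (2^i, 2^i)`), which is where the line's experiments are redirected
(`Cruxes/NewtonTauWeak/NOTES.md` §8, lead c2).

Main results: `LevelBound.ncard_extremePoints_le_two_mul_card_image` (planar geometry),
`vert_le_two_mul_card_levels`, `vert_binomialSum_le_levels` (the rung, registered stub),
`vert_binomialSum_hexagon_le`.  No definitions, no named facts.

References: KPTT arXiv:1308.2286 Conj. 1, §2; the geometry is [folklore].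
-/

-- the namespace mandated for this Theorems file repeats the component `ValiantsHypothesis`
set_option linter.dupNamespace false

noncomputable section

open scoped BigOperators
open MvPolynomial
open Summit.ValiantsHypothesis.ValiantsHypothesis.Theorems.NewtonTauWeak.Negative (vert)

namespace Summit.ValiantsHypothesis.ValiantsHypothesis.Theorems.NewtonUnitEquationsNewtonTauWeak

namespace LevelBound

/-! ## §1 Planar geometry: at most two extreme points per level line -/

/-- A vector of `ℝ²` killed by a nonzero functional `(a, b)` and by its rotation `(-b, a)` is zero.
[folklore] -/
theorem eq_zero_of_levels {a b : ℝ} (hab : a ≠ 0 ∨ b ≠ 0) {z : Fin 2 → ℝ}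
    (h1 : a * z 0 + b * z 1 = 0) (h2 : -b * z 0 + a * z 1 = 0) : z = 0 := by
  have hd : a ^ 2 + b ^ 2 ≠ 0 := by
    rcases hab with ha | hb
    · have : 0 < a ^ 2 := by positivity
      positivity
    · have : 0 < b ^ 2 := by positivity
      positivity
  have hz0 : (a ^ 2 + b ^ 2) * z 0 = 0 := by linear_combination a * h1 - b * h2
  have hz1 : (a ^ 2 + b ^ 2) * z 1 = 0 := by linear_combination b * h1 + a * h2
  have h0 : z 0 = 0 := (mul_eq_zero.mp hz0).resolve_left hd
  have h1' : z 1 = 0 := (mul_eq_zero.mp hz1).resolve_left hd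
  funext i
  fin_cases i
  · simpa using h0
  · simpa using h1'

/-- Two distinct points on a level line have distinct transverse coordinates. [folklore] -/
theorem transverse_ne_of_ne {a b : ℝ} (hab : a ≠ 0 ∨ b ≠ 0) {p q : Fin 2 → ℝ}
    (hl : a * p 0 + b * p 1 = a * q 0 + b * q 1) (hne : p ≠ q) :
    -b * p 0 + a * p 1 ≠ -b * q 0 + a * q 1 := by
  intro ht
  apply hne
  have h : p - q = 0 := by
    refine eq_zero_of_levels hab ?_ ?_
    · simp only [Pi.sub_apply]
      linear_combination hl
    · simp only [Pi.sub_apply]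
      linear_combination ht
  exact sub_eq_zero.mp h

/-- Three points on a level line, ordered by the transverse coordinate: the middle one lies in the
open segment of the outer two. [folklore] -/
theorem mem_openSegment_of_levels {a b : ℝ} (hab : a ≠ 0 ∨ b ≠ 0) {p q r : Fin 2 → ℝ}
    (hpq : a * p 0 + b * p 1 = a * q 0 + b * q 1) (hqr : a * q 0 + b * q 1 = a * r 0 + b * r 1)
    (ht1 : -b * p 0 + a * p 1 < -b * q 0 + a * q 1) (ht2 : -b * q 0 + a * q 1 < -b * r 0 + a * r 1) :
    q ∈ openSegment ℝ p r := by
  have hden : 0 < (-b * r 0 + a * r 1) - (-b * p 0 + a * p 1) := by linarith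
  set μ : ℝ := ((-b * q 0 + a * q 1) - (-b * p 0 + a * p 1)) / ((-b * r 0 + a * r 1) - (-b * p 0 + a * p 1))
    with hμ
  have hμ0 : 0 < μ := div_pos (by linarith) hden
  have hμ1 : μ < 1 := (div_lt_one hden).mpr (by linarith)
  have hμdef : μ * ((-b * r 0 + a * r 1) - (-b * p 0 + a * p 1))
      = (-b * q 0 + a * q 1) - (-b * p 0 + a * p 1) := div_mul_cancel₀ _ (ne_of_gt hden)
  refine ⟨1 - μ, μ, by linarith, hμ0, by ring, ?_⟩
  -- the candidate combination has the same level and the same transverse coordinate as `q`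
  have key : q - ((1 - μ) • p + μ • r) = 0 := by
    refine eq_zero_of_levels hab ?_ ?_
    · simp only [Pi.sub_apply, Pi.add_apply, Pi.smul_apply, smul_eq_mul]
      linear_combination (μ - 1) * hpq + μ * hqr
    · simp only [Pi.sub_apply, Pi.add_apply, Pi.smul_apply, smul_eq_mul]
      linear_combination (-1 : ℝ) * hμdef
  exact (sub_eq_zero.mp key).symm

open scoped Classical in
/-- **At most two extreme points of `conv S` on any level line.** [folklore] -/
theorem card_filter_level_le_two (S : Finset (Fin 2 → ℝ)) {a b : ℝ} (hab : a ≠ 0 ∨ b ≠ 0) (v : ℝ) :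
    ((S.filter fun x => x ∈ (convexHull ℝ (S : Set (Fin 2 → ℝ))).extremePoints ℝ).filter
      fun x => a * x 0 + b * x 1 = v).card ≤ 2 := by
  classical
  set F := (S.filter fun x => x ∈ (convexHull ℝ (S : Set (Fin 2 → ℝ))).extremePoints ℝ).filter
      fun x => a * x 0 + b * x 1 = v with hF
  have hmemF : ∀ x ∈ F, x ∈ (convexHull ℝ (S : Set (Fin 2 → ℝ))).extremePoints ℝ ∧ a * x 0 + b * x 1 = v := by
    intro x hx
    simp only [hF, Finset.mem_filter] at hx
    exact ⟨hx.1.2, hx.2⟩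
  rcases le_or_gt F.card 2 with hle | hgt
  · exact hle
  exfalso
  -- transverse coordinate
  let t : (Fin 2 → ℝ) → ℝ := fun x => -b * x 0 + a * x 1
  have hne : F.Nonempty := Finset.card_pos.mp (by omega)
  obtain ⟨p, hp, hpmin⟩ := F.exists_min_image t hne
  obtain ⟨r, hr, hrmax⟩ := F.exists_max_image t hne
  -- a third point
  have hcard : 0 < ((F.erase p).erase r).card := by
    have h1 : (F.erase p).card = F.card - 1 := Finset.card_erase_of_mem hp
    have h2 : ((F.erase p).erase r).card ≥ (F.erase p).card - 1 := by
      by_cases hrp : r ∈ F.erase p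
      · rw [Finset.card_erase_of_mem hrp]
      · rw [Finset.erase_eq_of_notMem hrp]; omega
    omega
  obtain ⟨q, hq⟩ := Finset.card_pos.mp hcard
  have hqr : q ≠ r := Finset.ne_of_mem_erase hq
  have hq' : q ∈ F.erase p := Finset.mem_of_mem_erase hq
  have hqp : q ≠ p := Finset.ne_of_mem_erase hq'
  have hqF : q ∈ F := Finset.mem_of_mem_erase hq'
  obtain ⟨hpE, hpl⟩ := hmemF p hp
  obtain ⟨hqE, hql⟩ := hmemF q hqF
  obtain ⟨hrE, hrl⟩ := hmemF r hr
  -- strict transverse order `t p < t q < t r`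
  have htpq : t p < t q :=
    lt_of_le_of_ne (hpmin q hqF) (transverse_ne_of_ne hab (hpl.trans hql.symm) (Ne.symm hqp))
  have htqr : t q < t r :=
    lt_of_le_of_ne (hrmax q hqF) (transverse_ne_of_ne hab (hql.trans hrl.symm) hqr)
  have hseg : q ∈ openSegment ℝ p r :=
    mem_openSegment_of_levels hab (hpl.trans hql.symm) (hql.trans hrl.symm) htpq htqr
  -- `q` is extreme, `p, r` lie in the hull: contradiction
  have hpH : p ∈ convexHull ℝ (S : Set (Fin 2 → ℝ)) := hpE.1
  have hrH : r ∈ convexHull ℝ (S : Set (Fin 2 → ℝ)) := hrE.1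
  exact hqp (hqE.2 hpH hrH hseg).symm

open scoped Classical in
/-- **A planar convex hull has at most two extreme points per level**:
`#ext(conv S) ≤ 2 · #ℓ(S)` for every nonzero linear functional `ℓ = (a, b)`. [folklore] -/
theorem ncard_extremePoints_le_two_mul_card_image (S : Finset (Fin 2 → ℝ)) {a b : ℝ}
    (hab : a ≠ 0 ∨ b ≠ 0) :
    ((convexHull ℝ (S : Set (Fin 2 → ℝ))).extremePoints ℝ).ncard
      ≤ 2 * (S.image fun x => a * x 0 + b * x 1).card := by
  classical
  set E := S.filter fun x => x ∈ (convexHull ℝ (S : Set (Fin 2 → ℝ))).extremePoints ℝ with hE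
  have hEq : (convexHull ℝ (S : Set (Fin 2 → ℝ))).extremePoints ℝ = (E : Set (Fin 2 → ℝ)) := by
    ext x
    simp only [hE, Finset.coe_filter, Set.mem_setOf_eq]
    constructor
    · intro hx
      exact ⟨extremePoints_convexHull_subset hx, hx⟩
    · rintro ⟨-, hx⟩
      exact hx
  rw [hEq, Set.ncard_coe_finset]
  calc E.card ≤ 2 * (E.image fun x => a * x 0 + b * x 1).card :=
        Finset.card_le_mul_card_image (f := fun x : Fin 2 → ℝ => a * x 0 + b * x 1) E 2
          (fun v _ => card_filter_level_le_two S hab v)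
    _ ≤ 2 * (S.image fun x => a * x 0 + b * x 1).card := by
        gcongr 2 * Finset.card ?_
        exact Finset.image_subset_image (Finset.filter_subset _ S)

end LevelBound

open LevelBound

/-! ## §2 Newton vertices versus levels -/

/-- **The level bound**: for every nonzero integer functional `ℓ(e) = a e₀ + b e₁`, the number of Newton
vertices of a bivariate polynomial is at most twice the number of values of `ℓ` on its support.
[folklore] -/
theorem vert_le_two_mul_card_levels (p : MvPolynomial (Fin 2) ℂ) {a b : ℤ} (hab : a ≠ 0 ∨ b ≠ 0) :
    vert p ≤ 2 * (p.support.image fun e : Fin 2 →₀ ℕ => a * (e 0 : ℤ) + b * (e 1 : ℤ)).card := by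
  classical
  unfold vert
  have hS : ((fun e : Fin 2 →₀ ℕ => fun i : Fin 2 => ((e i : ℕ) : ℝ)) '' (p.support : Set (Fin 2 →₀ ℕ)))
      = ((p.support.image fun e : Fin 2 →₀ ℕ => fun i : Fin 2 => ((e i : ℕ) : ℝ)) : Finset (Fin 2 → ℝ)) := by
    simp
  rw [hS]
  have hab' : (a : ℝ) ≠ 0 ∨ (b : ℝ) ≠ 0 := by
    rcases hab with h | h
    · exact Or.inl (by exact_mod_cast h)
    · exact Or.inr (by exact_mod_cast h)
  refine (ncard_extremePoints_le_two_mul_card_image _ hab').trans ?_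
  gcongr 2 * ?_
  rw [Finset.image_image]
  have hcomp : ((fun x : Fin 2 → ℝ => (a : ℝ) * x 0 + (b : ℝ) * x 1) ∘
        fun e : Fin 2 →₀ ℕ => fun i : Fin 2 => ((e i : ℕ) : ℝ))
      = (fun z : ℤ => (z : ℝ)) ∘ fun e : Fin 2 →₀ ℕ => a * (e 0 : ℤ) + b * (e 1 : ℤ) := by
    funext e
    simp only [Function.comp_apply]
    push_cast
    ring
  rw [hcomp, ← Finset.image_image]
  exact Finset.card_image_le

/-! ## §3 Levels of the stub's sum -/

/-- Every exponent in the support of `Σ_l C(c_l) Π_j (1 - C(ρ_{lj}) X^{d_j})` is a subset sum of the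
common exponent list. [folklore] -/
theorem exists_subset_sum_of_mem_support {K N : ℕ} (c : Fin K → ℂ) (ρ : Fin K → Fin N → ℂ)
    (d : Fin N → (Fin 2 →₀ ℕ)) {e : Fin 2 →₀ ℕ}
    (he : e ∈ (∑ l, C (c l) * ∏ j, (1 - C (ρ l j) * monomial (d j) (1 : ℂ)) : MvPolynomial (Fin 2) ℂ).support) :
    ∃ J : Finset (Fin N), e = ∑ j ∈ J, d j := by
  classical
  obtain ⟨l, -, hl⟩ := Finset.mem_biUnion.mp (support_sum he)
  have hfac : (∏ j, (1 - C (ρ l j) * monomial (d j) (1 : ℂ)) : MvPolynomial (Fin 2) ℂ)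
      = ∏ j, (1 + C (-ρ l j) * monomial (d j) (1 : ℂ)) := by
    refine Finset.prod_congr rfl fun j _ => ?_
    rw [map_neg, neg_mul, sub_eq_add_neg]
  rw [hfac, Summit.ValiantsHypothesis.Theorems.BinomialPencil.prod_binomial_eq_sum, Finset.mul_sum] at hl
  obtain ⟨T, -, hT⟩ := Finset.mem_biUnion.mp (support_sum hl)
  rw [C_mul_monomial] at hT
  exact ⟨T, by simpa using support_monomial_subset hT⟩

/-- The levels of subset sums lie in an integer interval of length `Σ_j |ℓ(d_j)|`. [folklore] -/
theorem level_subset_sum_mem_Icc {N : ℕ} (d : Fin N → (Fin 2 →₀ ℕ)) (a b : ℤ) (J : Finset (Fin N)) :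
    (a * ((∑ j ∈ J, d j : Fin 2 →₀ ℕ) 0 : ℤ) + b * ((∑ j ∈ J, d j : Fin 2 →₀ ℕ) 1 : ℤ))
      ∈ Finset.Icc (∑ j, min (a * (d j 0 : ℤ) + b * (d j 1 : ℤ)) 0)
          (∑ j, max (a * (d j 0 : ℤ) + b * (d j 1 : ℤ)) 0) := by
  classical
  have hlin : a * ((∑ j ∈ J, d j : Fin 2 →₀ ℕ) 0 : ℤ) + b * ((∑ j ∈ J, d j : Fin 2 →₀ ℕ) 1 : ℤ)
      = ∑ j ∈ J, (a * (d j 0 : ℤ) + b * (d j 1 : ℤ)) := by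
    simp only [Finsupp.coe_finsetSum, Finset.sum_apply, Nat.cast_sum, Finset.mul_sum,
      Finset.sum_add_distrib]
  rw [hlin, Finset.mem_Icc]
  constructor
  · have hneg : ∑ j ∈ J, -min (a * (d j 0 : ℤ) + b * (d j 1 : ℤ)) 0
        ≤ ∑ j, -min (a * (d j 0 : ℤ) + b * (d j 1 : ℤ)) 0 :=
      Finset.sum_le_sum_of_subset_of_nonneg (Finset.subset_univ J)
        (fun j _ _ => neg_nonneg.mpr (min_le_right _ _))
    rw [Finset.sum_neg_distrib, Finset.sum_neg_distrib, neg_le_neg_iff] at hneg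
    exact hneg.trans (Finset.sum_le_sum fun j _ => min_le_left _ _)
  · calc ∑ j ∈ J, (a * (d j 0 : ℤ) + b * (d j 1 : ℤ))
        ≤ ∑ j ∈ J, max (a * (d j 0 : ℤ) + b * (d j 1 : ℤ)) 0 :=
          Finset.sum_le_sum fun j _ => le_max_left _ _
      _ ≤ ∑ j, max (a * (d j 0 : ℤ) + b * (d j 1 : ℤ)) 0 :=
          Finset.sum_le_sum_of_subset_of_nonneg (Finset.subset_univ J)
            (fun j _ _ => le_max_right _ _)

/-- The number of levels of the stub's sum is at most `1 + Σ_j |ℓ(d_j)|`. [folklore] -/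
theorem card_levels_binomialSum_le {K N : ℕ} (c : Fin K → ℂ) (ρ : Fin K → Fin N → ℂ)
    (d : Fin N → (Fin 2 →₀ ℕ)) (a b : ℤ) :
    ((∑ l, C (c l) * ∏ j, (1 - C (ρ l j) * monomial (d j) (1 : ℂ)) : MvPolynomial (Fin 2) ℂ).support.image
        fun e : Fin 2 →₀ ℕ => a * (e 0 : ℤ) + b * (e 1 : ℤ)).card
      ≤ 1 + ∑ j, (a * (d j 0 : ℤ) + b * (d j 1 : ℤ)).natAbs := by
  classical
  set lo := ∑ j, min (a * (d j 0 : ℤ) + b * (d j 1 : ℤ)) 0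
  set hi := ∑ j, max (a * (d j 0 : ℤ) + b * (d j 1 : ℤ)) 0
  have hsub : ((∑ l, C (c l) * ∏ j, (1 - C (ρ l j) * monomial (d j) (1 : ℂ)) : MvPolynomial (Fin 2) ℂ).support.image
        fun e : Fin 2 →₀ ℕ => a * (e 0 : ℤ) + b * (e 1 : ℤ)) ⊆ Finset.Icc lo hi := by
    intro v hv
    obtain ⟨e, he, rfl⟩ := Finset.mem_image.mp hv
    obtain ⟨J, rfl⟩ := exists_subset_sum_of_mem_support c ρ d he
    exact level_subset_sum_mem_Icc d a b J
  refine (Finset.card_le_card hsub).trans ?_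
  rw [Int.card_Icc]
  have hj : ∀ j : Fin N, max (a * (d j 0 : ℤ) + b * (d j 1 : ℤ)) 0 - min (a * (d j 0 : ℤ) + b * (d j 1 : ℤ)) 0
      = ((a * (d j 0 : ℤ) + b * (d j 1 : ℤ)).natAbs : ℤ) := by
    intro j
    rcases le_total (a * (d j 0 : ℤ) + b * (d j 1 : ℤ)) 0 with h | h
    · rw [max_eq_right h, min_eq_left h, Int.ofNat_natAbs_of_nonpos h]; ring
    · rw [max_eq_left h, min_eq_right h, Int.natAbs_of_nonneg h]; ring
  have hdiff : hi + 1 - lo = ((1 + ∑ j, (a * (d j 0 : ℤ) + b * (d j 1 : ℤ)).natAbs : ℕ) : ℤ) := by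
    calc hi + 1 - lo = 1 + (hi - lo) := by ring
      _ = 1 + ∑ j, (max (a * (d j 0 : ℤ) + b * (d j 1 : ℤ)) 0 - min (a * (d j 0 : ℤ) + b * (d j 1 : ℤ)) 0) := by
          rw [Finset.sum_sub_distrib]
      _ = 1 + ∑ j, ((a * (d j 0 : ℤ) + b * (d j 1 : ℤ)).natAbs : ℤ) := by
          rw [Finset.sum_congr rfl fun j _ => hj j]
      _ = ((1 + ∑ j, (a * (d j 0 : ℤ) + b * (d j 1 : ℤ)).natAbs : ℕ) : ℤ) := by
          push_cast; rfl
  rw [hdiff, Int.toNat_natCast]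

/-! ## §4 The rung: the stub on exponent lists of bounded lattice width -/

/-- **The stub holds, uniformly in `K`, with the level count in place of `(K N + 2)^b`**: for every
nonzero `(a, b) ∈ ℤ²`,
`vert(Σ_{l<K} c_l Π_{j<N} (1 - ρ_{lj} X^{d_j})) ≤ 2 (1 + Σ_j |a (d_j)₀ + b (d_j)₁|)`.
So a counterexample to `stub_binomialNewtonTauCommon` must have super-polynomially many subset-sum
levels under every nonzero integer functional. [folklore] -/
theorem vert_binomialSum_le_levels (K N : ℕ) (c : Fin K → ℂ) (ρ : Fin K → Fin N → ℂ)
    (d : Fin N → (Fin 2 →₀ ℕ)) (a b : ℤ) (hab : a ≠ 0 ∨ b ≠ 0) :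
    vert (∑ l, C (c l) * ∏ j, (1 - C (ρ l j) * monomial (d j) 1))
      ≤ 2 * (1 + ∑ j, (a * (d j 0 : ℤ) + b * (d j 1 : ℤ)).natAbs) :=
  (vert_le_two_mul_card_levels _ hab).trans
    (Nat.mul_le_mul_left 2 (card_levels_binomialSum_le c ρ d a b))

/-- **Hexagon / block frames are closed for all `K`**: if every exponent is one of `(1,0)`, `(0,1)`,
`(1,1)` (any multiplicities, any `K`, any scalars and coefficients), then `vert ≤ 2 (N + 1)` — take the
functional `ℓ = x₀ - x₁`, whose values on the three exponents are `1, -1, 0`. [folklore] -/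
theorem vert_binomialSum_hexagon_le (K N : ℕ) (c : Fin K → ℂ) (ρ : Fin K → Fin N → ℂ)
    (d : Fin N → (Fin 2 →₀ ℕ))
    (hd : ∀ j, d j = Finsupp.single 0 1 ∨ d j = Finsupp.single 1 1 ∨
      d j = Finsupp.single 0 1 + Finsupp.single 1 1) :
    vert (∑ l, C (c l) * ∏ j, (1 - C (ρ l j) * monomial (d j) 1)) ≤ 2 * (N + 1) := by
  refine (vert_binomialSum_le_levels K N c ρ d 1 (-1) (Or.inl one_ne_zero)).trans ?_
  have hle : ∀ j, ((1 : ℤ) * (d j 0 : ℤ) + (-1) * (d j 1 : ℤ)).natAbs ≤ 1 := by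
    intro j
    rcases hd j with h | h | h <;> simp [h]
  calc 2 * (1 + ∑ j, ((1 : ℤ) * (d j 0 : ℤ) + (-1) * (d j 1 : ℤ)).natAbs)
      ≤ 2 * (1 + ∑ _j : Fin N, 1) := by
        gcongr with j
        exact hle j
    _ = 2 * (N + 1) := by simp [add_comm]

end Summit.ValiantsHypothesis.ValiantsHypothesis.Theorems.NewtonUnitEquationsNewtonTauWeak

end
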